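import Literature.Computability.AlgebraicComplexity.DeterminantBorderWaringRank
import HarnessLib
import HarnessLib.Audit

/-!
# `R̲_S(det₄) ≥ 38 / 39 / 41` and `R̲_S(perm₄) ≥ 39` from Koszul–Young flattening RANK CERTIFICATES
# (track F, finding F-R1): the printed inequality with the certified rank as an explicit hypothesis

Cell `pub-gct-max` (HOME `run/shared/lean/pub/pub-gct-max/`), track F (engine-3 `kyflat`, theory-2 FLAT-PLAN §J.8),
typed by track T (lit-2); lead ruling INBOX 2026-08-23T03:14:51Z (2) ("F-R1 as a decl with the rank certificate as
an EXPLICIT HYPOTHESIS … Farnsworth's printed 38 the same way"). HONEST FRAMING: multiplicity data and certified rank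
bounds at small parameters; this file is the typed form of ONE inequality of the printed flattening method
(Landsberg 2017 Prop. 8.2.1.1 / Farnsworth 2016 Prop. 2.4) evaluated at det₄, perm₄ with ranks CERTIFIED BY THE
CELL'S ENGINE and NOT replayed in Lean; `R̲_S(det₄) ≥ 41 > 38` is a CANDIDATE improvement of a printed bound by the
printed method at another Young diagram, pending the cell's literature re-check and referee re-derivation
(flat/F-READOUT.md); occurrence obstructions are ruled out in print (BIP'16) — multiplicity obstructions are the
open door; nothing here is a claim on VP vs VNP or P vs NP.

**What is a theorem here and what is a hypothesis.** THEOREMS (tree, sorry-free):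
`Literature.Computability.AlgebraicComplexity.lt_borderPolyWaringRank_detFin_of_mul_lt` — for `k < m`,
`r · binom(m² − 1, p) < rank KY_{p,k}(det_m) ⟹ r < R̲_S(det_m)` over `ℂ` (Prop. 8.2.1.1 PROVED for the Koszul–Young
flattening in `PolynomialKoszulYoungFlatteningBorderRank.lean`; the side condition "det_m has a border rank"
discharged by the Waring decomposition of every form over `ℂ`, `DeterminantBorderWaringRank.lean`); here
`KY_{p,k}(P) = P^{∧p}_{k,d−k} : S^kV^* ⊗ Λ^pV → S^{d−k−1}V ⊗ Λ^{p+1}V` (tree `kyRank ℂ p k`, numbering-free) and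
`R̲_S` = tree `borderPolyWaringRank` on `detFin ℂ 4 = det₄` in the 16 numbered variables. HYPOTHESES (each
theorem's `h`): the RANK lower bounds, which are finite exact-linear-algebra facts about explicit sparse integer
matrices, certified OUTSIDE Lean:

| cell `(p,k)` | matrix (rows × cols) | certified rank | certificate (HOME/flat/, INDEX.md rows) | bound |
|---|---|---|---|---|
| det₄ `(1,2)` = Farnsworth's `det_{2,2}^{∧1}` | 1920 × 2176 | ≥ 560 (print: proof of Thm. 3.7 at `n = 4`: `(1 + 4/108)·36·15 = 560`) | [Farnsworth2016, Thm. 3.7 / Thm. 1.6] | `R̲_S(det₄) ≥ 38` (PRINTED, Thm. 1.6) |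
| det₄ `(14,1)` (dual cell, same normaliser 15) | 2176 × 1920 | 560 (engine-3, exact) | flat/F-READOUT.md row "R̲_S(det₄)" | 38 (= print) |
| det₄ `(13,1)` | 16320 × 8960 | 4065 | `KY-QUARTICS/KY_det4_p13k1.cert.json` sha256/16 `db952590051927a2` (78-digit minor determinant, CRT 24 primes; 4895 exact kernel vectors) | 39 |
| det₄ `(12,1)` | 76160 × 29120 | 18256 | `KY-QUARTICS/KY_det4_p12k1.cert.json` sha256/16 `db7a95b70799d040` (named 18256-minor nonsingular mod 3 primes ⇒ nonsingular over ℤ; 10864 exact kernel vectors for the upper bound; engine `kyflat` v0.3 `cd87ea825f08`, job j176035) | **41** (F-R1) |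
| perm₄ `(13,1)` | 16320 × 8960 | 4053 | `KY-QUARTICS/KY_perm4_p13k1.cert.json` sha256/16 `40079126c0cd2424` (minor determinant 4096, CRT 23 primes; 4907 exact kernel vectors) | 39 |

PROVENANCE UPDATE (2026-08-23; engine-3 FLAT-PLAN T10, HOME INBOX l.514; lead D208 / D220): the COMPLETE det₄ and perm₄
Koszul–Young tables (64 + 64 cells, among them the cells above: `(14,1) = 560`, `(13,1) = 4065` resp. `4053`,
`(12,1) = 18256` resp. `18064`) are now EXACT OVER `ℚ` with TWO-SIDED certificates:
`KY-QUARTICS/exact_det4.j184804.json` sha256/16 `4df354fb25f5e1a2` and `KY-QUARTICS/exact_perm4.j184806.json`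
sha256/16 `2d64ad471191008a` (engine `kyflat` v0.6 `eaf7ff42f1dd`, `bprofile --exact`: per torus-weight block a pivot
minor nonsingular over `ℤ` ⇒ `rank ≥ r`, and `ncols − r` integer kernel vectors verified `M·v = 0` over `ℤ` ⇒ `rank ≤ r`;
208 200 blocks per polynomial, 10 075 215 / 10 075 201 kernel vectors verified, 0 failures; `rank_ℚ` equals the two-prime
tables of record, job j175878, on every cell) — a second, independent route to the same numbers inside one engine family
(blocked per-block certificates vs the dense exact kernels of j176035); the referee's re-derivation remains the external
leg. The hypotheses of the theorems below are UNCHANGED (no certificate is replayed in the kernel here).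

Normalisers `r₀ = rank KY_{p,k}(x^4) = binom(15, p)` (Guan 2015 Lemma 2.9 = tree `kyRankFin_X_pow`): `binom(15,1) =
binom(15,14) = 15`, `binom(15,13) = 105`, `binom(15,12) = 455`; the arithmetic `37·15 = 555 < 560`, `38·105 = 3990 <
4053 ≤ 4065`, `40·455 = 18200 < 18256` is checked by `decide` below. Only the LOWER rank bounds are used. What would
turn a hypothesis into a theorem: a kernel-replayed nonsingular minor (a `decide`/`norm_num` determinant of an
explicit `18256 × 18256` integer matrix is far beyond kernel reach; a block-structured or symbolic rank argument in
the style of Farnsworth §3 (Schur-module isomorphisms) is the realistic road and is NOT attempted here).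

Shape (lead ruling 2026-08-23T03:07:14Z (1)(ii)(α), as in `Conjectures/KYFlatteningBlindPaddedPerThree.lean`): each
inequality is an arrow-typed theorem `…_of_kyRank` AND a named statement `def … : Prop := certificate → bound`
with its proof `…_holds`, so that every declaration is reachable in the audit and no numeric certificate is asserted.

## References

* [Farnsworth2016] C. Farnsworth, *Koszul–Young flattenings and symmetric border rank of the determinant*,
  J. Algebra 447 (2016) 664–676: Thm. 1.6 (`R̲_s(det₄) ≥ 38`), Rem. 1.7 (previous bound 36), Prop. 2.4, Rem. 3.3
  and the definition of `det_{d,n−d}^{∧1}`, Thm. 3.7.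
* [LandsbergGCT2017] J. M. Landsberg, *Geometry and Complexity Theory*, CUP 2017, §8.2.1 eq. (8.2.1), Prop. 8.2.1.1.
* [Guan2016] Y. Guan, *Flattenings and Koszul Young flattenings arising in complexity theory*, Lemma 2.9.
-/

noncomputable section

namespace Summit.PneNP.GCT

open Literature.Computability.AlgebraicComplexity

/-! ## det₄: the printed bound 38 (Farnsworth 2016, Thm. 1.6) -/

/-- **`R̲_S(det₄) ≥ 38` from Farnsworth's own flattening** `det_{2,2}^{∧1} = KY_{1,2}(det₄)`: if its rank is at least
`560` (the value the proof of Thm. 3.7 exhibits at `n = 4`), then `37 < R̲_S(det₄)` since `37 · binom(15,1) = 555 < 560`.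
[cite: Farnsworth2016, Thm. 1.6 and Thm. 3.7] -/
theorem detFour_borderWaringRank_ge_38_of_kyRank (h : 560 ≤ kyRank ℂ 1 2 (detPoly (Fin 4) ℂ)) :
    38 ≤ borderPolyWaringRank 4 (detFin ℂ 4) :=
  Nat.succ_le_of_lt <| lt_borderPolyWaringRank_detFin_of_mul_lt (r := 37) (by norm_num) (lt_of_lt_of_le (by decide) h)

/-- Farnsworth's Thm. 1.6 with its rank as hypothesis, as a named statement. [cite: Farnsworth2016, Thm. 1.6] -/
def DetFourRank560GivesBorderRank38 : Prop :=
  560 ≤ kyRank ℂ 1 2 (detPoly (Fin 4) ℂ) → 38 ≤ borderPolyWaringRank 4 (detFin ℂ 4)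

/-- `DetFourRank560GivesBorderRank38` holds. [cite: Farnsworth2016, Thm. 1.6] -/
theorem detFourRank560GivesBorderRank38_holds : DetFourRank560GivesBorderRank38 :=
  fun h => detFour_borderWaringRank_ge_38_of_kyRank h

/-- The same bound from the DUAL cell `(p,k) = (14,1)` (engine-3's table; normaliser `binom(15,14) = 15`):
`560 ≤ rank KY_{14,1}(det₄) ⟹ 38 ≤ R̲_S(det₄)`. [cite: Farnsworth2016, Thm. 1.6] [cite: LandsbergGCT2017, Prop. 8.2.1.1] -/
theorem detFour_borderWaringRank_ge_38_of_kyRank_dual (h : 560 ≤ kyRank ℂ 14 1 (detPoly (Fin 4) ℂ)) :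
    38 ≤ borderPolyWaringRank 4 (detFin ℂ 4) :=
  Nat.succ_le_of_lt <| lt_borderPolyWaringRank_detFin_of_mul_lt (r := 37) (by norm_num) (lt_of_lt_of_le (by decide) h)

/-- Named statement for the dual cell `(14,1)`. [cite: Farnsworth2016, Thm. 1.6] -/
def DetFourRank560DualGivesBorderRank38 : Prop :=
  560 ≤ kyRank ℂ 14 1 (detPoly (Fin 4) ℂ) → 38 ≤ borderPolyWaringRank 4 (detFin ℂ 4)

/-- `DetFourRank560DualGivesBorderRank38` holds. [cite: Farnsworth2016, Thm. 1.6] -/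
theorem detFourRank560DualGivesBorderRank38_holds : DetFourRank560DualGivesBorderRank38 :=
  fun h => detFour_borderWaringRank_ge_38_of_kyRank_dual h

/-! ## det₄: the cell's certified cells `(13,1)` and `(12,1)` (F-R1) -/

/-- **`R̲_S(det₄) ≥ 39` from cell `(13,1)`**: `4065 ≤ rank KY_{13,1}(det₄) ⟹ 38 < R̲_S(det₄)` (`38 · binom(15,13) =
3990 < 4065`; rank certificate `KY-QUARTICS/KY_det4_p13k1`, not replayed here).
[cite: LandsbergGCT2017, Prop. 8.2.1.1] [cite: Farnsworth2016, Prop. 2.4] -/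
theorem detFour_borderWaringRank_ge_39_of_kyRank (h : 4065 ≤ kyRank ℂ 13 1 (detPoly (Fin 4) ℂ)) :
    39 ≤ borderPolyWaringRank 4 (detFin ℂ 4) :=
  Nat.succ_le_of_lt <| lt_borderPolyWaringRank_detFin_of_mul_lt (r := 38) (by norm_num) (lt_of_lt_of_le (by decide) h)

/-- Named statement: certificate `(13,1)` ⇒ `R̲_S(det₄) ≥ 39`. [cite: LandsbergGCT2017, Prop. 8.2.1.1] -/
def DetFourRank4065GivesBorderRank39 : Prop :=
  4065 ≤ kyRank ℂ 13 1 (detPoly (Fin 4) ℂ) → 39 ≤ borderPolyWaringRank 4 (detFin ℂ 4)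

/-- `DetFourRank4065GivesBorderRank39` holds. [cite: LandsbergGCT2017, Prop. 8.2.1.1] -/
theorem detFourRank4065GivesBorderRank39_holds : DetFourRank4065GivesBorderRank39 :=
  fun h => detFour_borderWaringRank_ge_39_of_kyRank h

/-- **F-R1: `R̲_S(det₄) ≥ 41` from cell `(12,1)`**: `18256 ≤ rank KY_{12,1}(det₄) ⟹ 40 < R̲_S(det₄)`
(`40 · binom(15,12) = 18200 < 18256`; rank certificate `KY-QUARTICS/KY_det4_p12k1`: a named `18256 × 18256` minor of
the `76160 × 29120` flattening matrix nonsingular modulo three primes, not replayed here). Printed bound: 38.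
[cite: LandsbergGCT2017, Prop. 8.2.1.1] [cite: Farnsworth2016, Prop. 2.4 and Thm. 1.6] -/
theorem detFour_borderWaringRank_ge_41_of_kyRank (h : 18256 ≤ kyRank ℂ 12 1 (detPoly (Fin 4) ℂ)) :
    41 ≤ borderPolyWaringRank 4 (detFin ℂ 4) :=
  Nat.succ_le_of_lt <| lt_borderPolyWaringRank_detFin_of_mul_lt (r := 40) (by norm_num) (lt_of_lt_of_le (by decide) h)

/-- Named statement (F-R1): certificate `(12,1)` ⇒ `R̲_S(det₄) ≥ 41`. [cite: LandsbergGCT2017, Prop. 8.2.1.1] -/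
def DetFourRank18256GivesBorderRank41 : Prop :=
  18256 ≤ kyRank ℂ 12 1 (detPoly (Fin 4) ℂ) → 41 ≤ borderPolyWaringRank 4 (detFin ℂ 4)

/-- `DetFourRank18256GivesBorderRank41` holds. [cite: LandsbergGCT2017, Prop. 8.2.1.1] -/
theorem detFourRank18256GivesBorderRank41_holds : DetFourRank18256GivesBorderRank41 :=
  fun h => detFour_borderWaringRank_ge_41_of_kyRank h

/-! ## perm₄: the cell's certified cell `(13,1)` -/

/-- **`R̲_S(perm₄) ≥ 39` from cell `(13,1)`**: `4053 ≤ rank KY_{13,1}(perm₄) ⟹ 38 < R̲_S(perm₄)`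
(`38 · binom(15,13) = 3990 < 4053`; rank certificate `KY-QUARTICS/KY_perm4_p13k1`, not replayed here).
[cite: LandsbergGCT2017, Prop. 8.2.1.1] [cite: Farnsworth2016, Prop. 2.4] -/
theorem perFour_borderWaringRank_ge_39_of_kyRank (h : 4053 ≤ kyRank ℂ 13 1 (perPoly (Fin 4) ℂ)) :
    39 ≤ borderPolyWaringRank 4 (perFin ℂ 4) :=
  Nat.succ_le_of_lt <| lt_borderPolyWaringRank_perFin_of_mul_lt (r := 38) (by norm_num) (lt_of_lt_of_le (by decide) h)

/-- Named statement: certificate `(13,1)` ⇒ `R̲_S(perm₄) ≥ 39`. [cite: LandsbergGCT2017, Prop. 8.2.1.1] -/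
def PerFourRank4053GivesBorderRank39 : Prop :=
  4053 ≤ kyRank ℂ 13 1 (perPoly (Fin 4) ℂ) → 39 ≤ borderPolyWaringRank 4 (perFin ℂ 4)

/-- `PerFourRank4053GivesBorderRank39` holds. [cite: LandsbergGCT2017, Prop. 8.2.1.1] -/
theorem perFourRank4053GivesBorderRank39_holds : PerFourRank4053GivesBorderRank39 :=
  fun h => perFour_borderWaringRank_ge_39_of_kyRank h

end Summit.PneNP.GCT
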